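import Mathlib
import HarnessLib
import Summits.CriticalPhenomena.Ising3DConformalLimit.Theorems.HyperoctahedralRPTwoPointKernelOfLimitClauses
import Summits.CriticalPhenomena.Ising3DConformalLimit.Theorems.HarmonicMomentsIsotropyTwoPointAsymptoticIsotropyLatticeIntegral
import Literature.Probability.LatticeModels.HighDimPointwiseTriviality
import Literature.Probability.LatticeModels.CriticalScalingDimension

/-!
# Vague asymptotic isotropy of the critical `ℤ³` two-point function from a scale-covariant limit, II:
# bulk convergence of rescaled lattice sums against the scaling-limit kernel
(route HarmonicMomentsIsotropy, support item stmt-CriticalPhenomena-6036 `TwoPointAsymptoticIsotropy`;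
helper file 2/4 of the conditional line `ExistsScaleCovariantLimit → TwoPointAsymptoticIsotropy`)

Let `S` be a pointwise scaling limit of the critical nearest-neighbour Ising correlators on `ℤ³`
(`HasPointwiseScalingLimit (criticalCorr 3) ρ S`: locally uniform convergence on non-coincident
configurations) and `K(y) = S₂(0, y)` its two-point kernel. The main result of this file,
`tendsto_scaled_latticeSum`, is the Riemann-sum statement behind the lattice-to-continuum transfer:
for every bounded `Ψ : ℝ³ → ℝ` which is continuous almost everywhere and vanishes near the origin
(`‖y‖ < ε`) and near infinity (`‖y‖ > M`),

  `δ³ ρ(δ)² Σ_{x ∈ ℤ³} Ψ(δx) ⟨σ₀σ_x⟩_{β_c}  →  ∫_{ℝ³} Ψ(y) K(y) dy`   as `δ → 0⁺`.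

Proof: by file I (`cube_mul_tsum_eq_integral`) the left side is the integral of the step function
`y ↦ Ψ(δ[y/δ]) · ρ(δ)²⟨σ₀σ_{[y/δ]}⟩_{β_c}`; off the origin and the discontinuity set of `Ψ` it
converges pointwise (`δ[y/δ] → y`, and `ρ(δ)²⟨σ₀σ_{[y/δ]}⟩ → K(y)` is the scaling-limit hypothesis at
the pair `(0, y)`), and it is dominated by a constant multiple of the indicator of a ball, because the
rescaled pair correlators are uniformly bounded on the compact shell `{ε/2 ≤ ‖y‖ ≤ M + 1}` for small
`δ` (uniform convergence on compacts, `exists_eventually_rescaled_two_le`); dominated convergence.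
No regularity of `⟨σ₀σ_x⟩_{β_c}` beyond `0 ≤ ⟨σ₀σ_x⟩ ≤ 1` is used here.

References: G. B. Folland, *Real Analysis* (1999), Thm. 2.24 (dominated convergence); H. Duminil-Copin,
ICM 2022, §8.1 (context). No definitions are introduced.
-/

noncomputable section

namespace Summit.CriticalPhenomena.Ising3DConformalLimit.HarmonicMomentsIsotropyTwoPoint

open Literature.Probability.LatticeModels MeasureTheory Filter Set Metric
open scoped Topology
open Summit.CriticalPhenomena.Ising3DConformalLimit.HyperoctahedralRPTwoPoint

variable {ρ : ℝ → ℝ} {S : CorrFamily 3}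

/-- The rescaled pair correlator at `(0, y)` is `ρ(δ)² ⟨σ₀ σ_{[y/δ]}⟩_{β_c}`. [folklore] -/
theorem rescaledCorrelator_zero_pair (ρ : ℝ → ℝ) (δ : ℝ) (y : EuclideanSpace ℝ (Fin 3)) :
    rescaledCorrelator (criticalCorr 3) ρ 2 δ ![0, y] =
      ρ δ ^ 2 * criticalTwoPoint 3 (latticeApprox δ y) := by
  rw [rescaledCorrelator_apply, latticeApprox_comp_two]
  simp only [Matrix.cons_val_zero, Matrix.cons_val_one, Matrix.cons_val_fin_one, latticeApprox_zero,
    criticalCorr_two]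

/-- Pointwise convergence of the rescaled two-point function to the kernel `K(y) = S₂(0, y)` off the
origin. [folklore] -/
theorem tendsto_rescaled_twoPoint (hlim : HasPointwiseScalingLimit (criticalCorr 3) ρ S)
    {y : EuclideanSpace ℝ (Fin 3)} (hy : y ≠ 0) :
    Tendsto (fun δ : ℝ => ρ δ ^ 2 * criticalTwoPoint 3 (latticeApprox δ y)) (𝓝[>] (0:ℝ))
      (𝓝 (S 2 ![0, y])) := by
  have h := (hlim 2).tendsto_at (zero_pair_mem_nonCoincident hy)
  simp_rw [rescaledCorrelator_zero_pair] at h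
  exact h

/-- Uniform boundedness of the rescaled two-point function on a closed shell
`{ε ≤ ‖y‖ ≤ M}` (`ε > 0`), for all small `δ > 0`. [folklore] -/
theorem exists_eventually_rescaled_twoPoint_le (hlim : HasPointwiseScalingLimit (criticalCorr 3) ρ S)
    {ε M : ℝ} (hε : 0 < ε) :
    ∃ C : ℝ, 0 ≤ C ∧ ∀ᶠ δ in 𝓝[>] (0 : ℝ), ∀ y : EuclideanSpace ℝ (Fin 3), ε ≤ ‖y‖ → ‖y‖ ≤ M →
      ρ δ ^ 2 * criticalTwoPoint 3 (latticeApprox δ y) ≤ C := by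
  set Q : Set (EuclideanSpace ℝ (Fin 3)) := {y | ε ≤ ‖y‖ ∧ ‖y‖ ≤ M} with hQ
  have hQc : IsCompact Q := by
    refine Metric.isCompact_of_isClosed_isBounded ?_ ?_
    · exact (isClosed_le continuous_const continuous_norm).inter
        (isClosed_le continuous_norm continuous_const)
    · refine (isBounded_closedBall (x := (0 : EuclideanSpace ℝ (Fin 3))) (r := M)).subset ?_
      intro y hy
      rw [mem_closedBall, dist_zero_right]
      exact hy.2
  set K : Set (Fin 2 → EuclideanSpace ℝ (Fin 3)) :=
    (fun y : EuclideanSpace ℝ (Fin 3) => (![0, y] : Fin 2 → EuclideanSpace ℝ (Fin 3))) '' Q with hK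
  have hKc : IsCompact K := hQc.image continuous_zeroPair
  have hKs : K ⊆ NonCoincident 3 2 := by
    rintro _ ⟨y, hy, rfl⟩
    refine zero_pair_mem_nonCoincident fun h0 => ?_
    have hy' : ε ≤ ‖y‖ := hy.1
    rw [h0, norm_zero] at hy'
    linarith
  obtain ⟨C, hC⟩ := exists_eventually_rescaled_two_le (d := 3) le_rfl hlim hKc hKs
  refine ⟨max C 0, le_max_right _ _, hC.mono fun δ hδ y hy1 hy2 => ?_⟩
  have h := hδ _ ⟨y, ⟨hy1, hy2⟩, rfl⟩
  rw [latticeApprox_comp_two] at h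
  simp only [Matrix.cons_val_zero, Matrix.cons_val_one, Matrix.cons_val_fin_one, latticeApprox_zero,
    criticalCorr_two] at h
  exact h.trans (le_max_left _ _)

/-- **Bulk convergence of rescaled lattice sums.** Let `S` be a pointwise scaling limit of the
critical `ℤ³` correlators with renormalisation `ρ`, and `K(y) = S₂(0, y)`. If `Ψ : ℝ³ → ℝ` is
bounded, Borel, continuous almost everywhere, and vanishes on `{‖y‖ < ε}` (`ε > 0`) and on
`{‖y‖ > M}`, then `δ³ ρ(δ)² Σ_{x ∈ ℤ³} Ψ(δx) ⟨σ₀σ_x⟩_{β_c} → ∫ Ψ K` as `δ → 0⁺`: the lattice sum is the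
integral of the step function `Ψ(δ[y/δ]) ρ(δ)²⟨σ₀σ_{[y/δ]}⟩`, which converges pointwise off a null
set and is dominated (uniform convergence on the compact shell `{ε/2 ≤ ‖y‖ ≤ M+1}`).
[cite: Folland1999, Thm. 2.24 (dominated convergence)] -/
theorem tendsto_scaled_latticeSum (hlim : HasPointwiseScalingLimit (criticalCorr 3) ρ S)
    {Ψ : EuclideanSpace ℝ (Fin 3) → ℝ} {B ε M : ℝ} (hB : ∀ y, |Ψ y| ≤ B) (hε : 0 < ε)
    (hΨε : ∀ y, ‖y‖ < ε → Ψ y = 0) (hΨM : ∀ y, M < ‖y‖ → Ψ y = 0)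
    (hcont : ∀ᵐ y ∂(volume : Measure (EuclideanSpace ℝ (Fin 3))), ContinuousAt Ψ y) :
    Tendsto (fun δ : ℝ => δ ^ 3 * ρ δ ^ 2 *
        ∑' x : Site 3, Ψ (δ • siteVec x) * criticalTwoPoint 3 x)
      (𝓝[>] (0:ℝ)) (𝓝 (∫ y, Ψ y * S 2 ![0, y])) := by
  -- the step functions
  set F : ℝ → EuclideanSpace ℝ (Fin 3) → ℝ := fun δ y =>
    Ψ (δ • siteVec (latticeApprox δ y)) * (ρ δ ^ 2 * criticalTwoPoint 3 (latticeApprox δ y)) with hF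
  have hB0 : 0 ≤ B := (abs_nonneg _).trans (hB 0)
  -- Step 1: the lattice sum is the integral of the step function
  have heq : (fun δ : ℝ => ∫ y, F δ y) =ᶠ[𝓝[>] (0:ℝ)] fun δ => δ ^ 3 * ρ δ ^ 2 *
      ∑' x : Site 3, Ψ (δ • siteVec x) * criticalTwoPoint 3 x := by
    filter_upwards [self_mem_nhdsWithin] with δ hδ
    rw [show δ ^ 3 * ρ δ ^ 2 * ∑' x : Site 3, Ψ (δ • siteVec x) * criticalTwoPoint 3 x =
      ρ δ ^ 2 * (δ ^ 3 * ∑' x : Site 3, Ψ (δ • siteVec x) * criticalTwoPoint 3 x) by ring,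
      cube_mul_tsum_eq_integral (mem_Ioi.1 hδ) hΨM, ← integral_const_mul]
    refine integral_congr_ae (Eventually.of_forall fun y => ?_)
    simp only [hF]
    ring
  -- Step 2: the uniform bound on the shell `ε/2 ≤ ‖y‖ ≤ M + 1`
  obtain ⟨C, hC0, hC⟩ := exists_eventually_rescaled_twoPoint_le hlim (ε := ε / 2) (M := M + 1)
    (half_pos hε)
  have hsmall : ∀ᶠ δ in 𝓝[>] (0:ℝ), δ < min (ε / 4) (1 / 2) :=
    (eventually_lt_nhds (by positivity)).filter_mono nhdsWithin_le_nhds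
  set bound : EuclideanSpace ℝ (Fin 3) → ℝ :=
    (closedBall (0 : EuclideanSpace ℝ (Fin 3)) (M + 1)).indicator fun _ => B * C with hbound
  have h_bound : ∀ᶠ δ in 𝓝[>] (0:ℝ), ∀ᵐ y ∂(volume : Measure (EuclideanSpace ℝ (Fin 3))),
      ‖F δ y‖ ≤ bound y := by
    filter_upwards [hC, hsmall, self_mem_nhdsWithin] with δ hCδ hδs hδpos
    refine Eventually.of_forall fun y => ?_
    have hδ : 0 < δ := hδpos
    have hδε : δ < ε / 4 := hδs.trans_le (min_le_left _ _)
    have hδ1 : δ < 1 / 2 := hδs.trans_le (min_le_right _ _)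
    set p := δ • siteVec (latticeApprox δ y) with hp
    by_cases hΨp : Ψ p = 0
    · have : F δ y = 0 := by simp only [hF, ← hp, hΨp, zero_mul]
      rw [this, norm_zero, hbound]
      exact Set.indicator_nonneg (fun _ _ => mul_nonneg hB0 hC0) _
    · have hpε : ε ≤ ‖p‖ := not_lt.1 fun h => hΨp (hΨε p h)
      have hpM : ‖p‖ ≤ M := not_lt.1 fun h => hΨp (hΨM p h)
      have hdist : ‖p - y‖ ≤ 2 * δ := norm_smul_siteVec_latticeApprox_sub_le hδ y
      have hy1 : ε / 2 ≤ ‖y‖ := by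
        have := norm_sub_norm_le p y
        linarith
      have hy2 : ‖y‖ ≤ M + 1 := by
        have := norm_sub_norm_le y p
        rw [norm_sub_rev] at this
        linarith
      have hG := hCδ y hy1 hy2
      have hG0 : 0 ≤ ρ δ ^ 2 * criticalTwoPoint 3 (latticeApprox δ y) :=
        mul_nonneg (sq_nonneg _) (criticalTwoPoint_nonneg' _)
      have hmem : y ∈ closedBall (0 : EuclideanSpace ℝ (Fin 3)) (M + 1) := by
        rw [mem_closedBall, dist_zero_right]; exact hy2
      rw [hbound, indicator_of_mem hmem, hF]
      simp only [← hp]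
      rw [norm_mul, Real.norm_eq_abs, Real.norm_eq_abs, abs_of_nonneg hG0]
      exact mul_le_mul (hB p) hG (hG0) hB0
  -- Step 3: measurability and integrability of the bound
  have h_meas : ∀ᶠ δ in 𝓝[>] (0:ℝ),
      AEStronglyMeasurable (F δ) (volume : Measure (EuclideanSpace ℝ (Fin 3))) := by
    refine Eventually.of_forall fun δ => ?_
    have hg : Measurable fun x : Site 3 =>
        Ψ (δ • siteVec x) * (ρ δ ^ 2 * criticalTwoPoint 3 x) := measurable_of_countable _
    exact (hg.comp (measurable_latticeApprox δ)).aestronglyMeasurable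
  have h_int : Integrable bound (volume : Measure (EuclideanSpace ℝ (Fin 3))) := by
    rw [hbound, integrable_indicator_iff measurableSet_closedBall]
    exact integrableOn_const (measure_closedBall_lt_top.ne)
  -- Step 4: pointwise convergence off the null set `{0} ∪ {discontinuities of Ψ}`
  have h_ne : ∀ᵐ y ∂(volume : Measure (EuclideanSpace ℝ (Fin 3))), y ≠ (0 : EuclideanSpace ℝ (Fin 3)) := by
    rw [ae_iff]
    simp
  have h_lim : ∀ᵐ y ∂(volume : Measure (EuclideanSpace ℝ (Fin 3))),
      Tendsto (fun δ => F δ y) (𝓝[>] (0:ℝ)) (𝓝 (Ψ y * S 2 ![0, y])) := by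
    filter_upwards [hcont, h_ne] with y hcy hy
    have h1 : Tendsto (fun δ : ℝ => Ψ (δ • siteVec (latticeApprox δ y))) (𝓝[>] (0:ℝ)) (𝓝 (Ψ y)) :=
      hcy.tendsto.comp (tendsto_smul_siteVec_latticeApprox y)
    exact h1.mul (tendsto_rescaled_twoPoint hlim hy)
  have hmain := tendsto_integral_filter_of_dominated_convergence bound h_meas h_bound h_int h_lim
  exact hmain.congr' heq

end Summit.CriticalPhenomena.Ising3DConformalLimit.HarmonicMomentsIsotropyTwoPoint

end
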